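import Mathlib

/-!
# Kernel-definite junction, part 8d: compressions to the kernel of the junction letter

Helper file for the stub `stub_kernelDefiniteJunction` of the line `junction_ceiling` (crux `MatrixDescartes`,
stmt-ValiantsHypothesis-18050).  Linear algebra of the diagonalised junction letter `J = U diag(λ) Uᵀ` (`U Uᵀ = 1`):
* `det_kernelCompression_ne_zero` — if a letter `N` is anisotropic on `ker J` (`vᵀ N v ≠ 0` for `0 ≠ v ∈ ker J`),
  then its compression `(Uᵀ N U)|_{λ = 0}` to the zero eigen-coordinates is nonsingular;
* `rank_eq_card_ne_zero` — `rank J = #{i : λ_i ≠ 0}`, hence `m − rank J = #{i : λ_i = 0}`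
  (`corank_eq_card_eq_zero`);
* `prod_ne_zero_eigs` — `∏_{λ_i ≠ 0} λ_i ≠ 0`.
[folklore]
-/

-- `Summit.ValiantsHypothesis.ValiantsHypothesis.…` is the tree's mandated single-conjunct layout (Sub = Summit).
set_option linter.dupNamespace false
set_option autoImplicit false

namespace Summit.ValiantsHypothesis.ValiantsHypothesis.Theorems.LacunarySymmetroidMatrixDescartes.JunctionCeiling

open Matrix Finset
open scoped BigOperators

section Kernel

variable {m : ℕ} (U : Matrix (Fin m) (Fin m) ℝ) (lam : Fin m → ℝ) (J : Matrix (Fin m) (Fin m) ℝ)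

/-- extension by zero of a vector on the zero eigen-coordinates. [folklore] -/
theorem mulVec_extend_eq (N : Matrix (Fin m) (Fin m) ℝ) (y : {i : Fin m // lam i = 0} → ℝ)
    (i : {i : Fin m // lam i = 0}) :
    (N *ᵥ (fun k => if h : lam k = 0 then y ⟨k, h⟩ else 0)) i.1 =
      ((Matrix.of fun i' k' : {i : Fin m // lam i = 0} => N i'.1 k'.1) *ᵥ y) i := by
  classical
  simp only [Matrix.mulVec, dotProduct, Matrix.of_apply]
  have h1 : (∑ x : {k : Fin m // lam k = 0}, N i.1 x.1 * y x) =
      ∑ x : {k : Fin m // lam k = 0}, (fun k : Fin m => N i.1 k * (if h : lam k = 0 then y ⟨k, h⟩ else 0)) x.1 :=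
    Finset.sum_congr rfl fun x _ => by simp only [dif_pos x.2]
  have h2 := Finset.sum_subtype (p := fun k => lam k = 0) (F := inferInstance)
    (Finset.univ.filter (fun k : Fin m => lam k = 0))
    (by intro x; simp) (fun k : Fin m => N i.1 k * (if h : lam k = 0 then y ⟨k, h⟩ else 0))
  rw [h1, ← h2, Finset.sum_filter]
  refine Finset.sum_congr rfl fun k _ => ?_
  by_cases hk : lam k = 0
  · rw [if_pos hk]
  · rw [if_neg hk, dif_neg hk, mul_zero]

/-- **anisotropy on `ker J` ⇒ the kernel compression is nonsingular.** [folklore] -/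
theorem det_kernelCompression_ne_zero (hU : U * Uᵀ = 1) (hJ : J = U * diagonal lam * Uᵀ)
    (N : Matrix (Fin m) (Fin m) ℝ) (hN : ∀ v : Fin m → ℝ, v ≠ 0 → J *ᵥ v = 0 → v ⬝ᵥ (N *ᵥ v) ≠ 0) :
    (Matrix.of fun i k : {i : Fin m // lam i = 0} => (Uᵀ * N * U) i.1 k.1).det ≠ 0 := by
  classical
  intro hdet
  obtain ⟨y, hy0, hy⟩ := Matrix.exists_mulVec_eq_zero_iff.2 hdet
  have hUU : Uᵀ * U = 1 := mul_eq_one_comm.1 hU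
  -- extend `y` by zero and rotate back
  set yh : Fin m → ℝ := fun k => if h : lam k = 0 then y ⟨k, h⟩ else 0 with hyh
  set v : Fin m → ℝ := U *ᵥ yh with hv
  have hyh0 : yh ≠ 0 := by
    intro h
    apply hy0
    funext i
    have := congrFun h i.1
    rw [hyh] at this
    simp only [i.2, dif_pos, Pi.zero_apply] at this
    exact this
  have hv0 : v ≠ 0 := by
    intro h
    apply hyh0
    have : Uᵀ *ᵥ v = yh := by rw [hv, mulVec_mulVec, hUU, one_mulVec]
    rw [← this, h, mulVec_zero]
  have hJv : J *ᵥ v = 0 := by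
    rw [hJ, hv, mulVec_mulVec, Matrix.mul_assoc, hUU, Matrix.mul_one, ← mulVec_mulVec]
    have : diagonal lam *ᵥ yh = 0 := by
      funext i
      rw [mulVec_diagonal, Pi.zero_apply, hyh]
      by_cases h : lam i = 0
      · rw [h, zero_mul]
      · simp [h]
    rw [this, mulVec_zero]
  have hquad : v ⬝ᵥ (N *ᵥ v) = 0 := by
    have h1 : v ⬝ᵥ (N *ᵥ v) = yh ⬝ᵥ ((Uᵀ * N * U) *ᵥ yh) := by
      rw [hv, ← mulVec_mulVec, ← mulVec_mulVec, dotProduct_mulVec yh Uᵀ, vecMul_transpose]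
    rw [h1, dotProduct]
    refine Finset.sum_eq_zero fun i _ => ?_
    by_cases hi : lam i = 0
    · have h2 := mulVec_extend_eq lam (Uᵀ * N * U) y ⟨i, hi⟩
      simp only at h2
      rw [← hyh] at h2
      rw [h2, hy, Pi.zero_apply, mul_zero]
    · rw [hyh]
      simp [hi]
  exact hN v hv0 hJv hquad

/-- `rank J = #{i : λ_i ≠ 0}`. [folklore] -/
theorem rank_eq_card_ne_zero (hU : U * Uᵀ = 1) (hJ : J = U * diagonal lam * Uᵀ) :
    J.rank = Fintype.card {i : Fin m // ¬ lam i = 0} := by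
  classical
  have hdet : IsUnit U.det := by
    have h := congrArg Matrix.det hU
    rw [det_mul, det_transpose, det_one] at h
    exact IsUnit.of_mul_eq_one _ h
  have hdetT : IsUnit Uᵀ.det := by rwa [det_transpose]
  rw [hJ, Matrix.rank_mul_eq_left_of_isUnit_det Uᵀ _ hdetT, Matrix.rank_mul_eq_right_of_isUnit_det U _ hdet,
    Matrix.rank_diagonal]

/-- `m − rank J = #{i : λ_i = 0}` (the corank). [folklore] -/
theorem corank_eq_card_eq_zero (hU : U * Uᵀ = 1) (hJ : J = U * diagonal lam * Uᵀ) :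
    m - J.rank = Fintype.card {i : Fin m // lam i = 0} := by
  classical
  rw [rank_eq_card_ne_zero U lam J hU hJ, Fintype.card_subtype_compl, Fintype.card_fin]
  have : Fintype.card {i : Fin m // lam i = 0} ≤ m := by
    calc Fintype.card {i : Fin m // lam i = 0} ≤ Fintype.card (Fin m) := Fintype.card_subtype_le _
      _ = m := Fintype.card_fin m
  omega

/-- `∏_{λ_i ≠ 0} λ_i ≠ 0`. [folklore] -/
theorem prod_ne_zero_eigs : (∏ i : {i : Fin m // ¬ lam i = 0}, lam i.1) ≠ 0 :=
  Finset.prod_ne_zero_iff.2 fun i _ => i.2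

/-- `#{i : λ_i = 0} ≤ m`. [folklore] -/
theorem card_eq_zero_le : Fintype.card {i : Fin m // lam i = 0} ≤ m := by
  calc Fintype.card {i : Fin m // lam i = 0} ≤ Fintype.card (Fin m) := Fintype.card_subtype_le _
    _ = m := Fintype.card_fin m

end Kernel

end Summit.ValiantsHypothesis.ValiantsHypothesis.Theorems.LacunarySymmetroidMatrixDescartes.JunctionCeiling
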